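import Summits.AtomisticToContinuum.FouriersLaw.Theorems.PhononMeanFreePathIncoherentChannelStrictForecastBudget
import Summits.AtomisticToContinuum.FouriersLaw.Theorems.PhononMeanFreePathIncoherentBoundedSumRule
import Summits.AtomisticToContinuum.FouriersLaw.Theses.PhononMeanFreePath

/-!
# The two CUMULANT channels together carry a fixed `N`-uniform weight (strict budget + sum rule)

Route `PhononMeanFreePath` (sub-problem `FouriersLaw`), crux `IncoherentChannel` (stmt-AtomisticToContinuum-11811), line
`two-horizons-forecast-loss`, lead c7 (registered helper stubs `cumulantChannels_floor`, `nearCumulantChannel_of_incoherentChannel`;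
`--supports`, nothing here closes an item).

The crux's integrand is the FAR cumulant channel `C_N − 2r_N²` (`powerCov − 2·pairCorr²`, the connected four-point function of the
two END momenta). Its same-site twin is the NEAR cumulant channel `A_N − 2a_N²`, `A_N(t) = Cov_{μ₀}(p₀², K_t p₀²)`,
`a_N(t) = ⟨p_N, K_t p_N⟩ = ⟨p₀, K_t p₀⟩` (site reflection). Two landed `N`-uniform facts — the SUM RULE `∫₀^∞(A_N + C_N) = T²/γ`
(`IncoherentBounded.sumRule`, Kundu–Dhar–Narayan) and the STRICT forecast budget `∫₀^∞(r_N² + a_N²) ≤ T²/(2γ) − c'`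
(`strictForecastBudget`, p157590 ← the sibling crux's strict absorption p135295) — give:

* `cumulantChannels_floor` — `∃ c > 0, ∀ N ≥ 2: ∫₀^∞(C_N − 2r_N²) + ∫₀^∞(A_N − 2a_N²) ≥ c`: the time-integrated connected
  four-point weight of the two channels TOGETHER is bounded below uniformly in the length (at `lam = β = 0` both integrands vanish
  identically — Wick). The crux asserts that the FAR share is exactly `κT²/(γ²N)(1 + o(1))`;
* `nearCumulantChannel_of_incoherentChannel` — hence `IncoherentChannel` forces the NEAR channel to stay order one:
  eventually `∫₀^∞(A_N − 2a_N²) ≥ c/2`: all but a `1/N` fraction of the anharmonic (incoherent) budget is re-absorbed at the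
  bath where it was injected (the gambler's-ruin picture of the conserved budget between two absorbers, now with a proved floor).

No definition, no `sorry`, standard axioms.
-/

noncomputable section

namespace Summit.AtomisticToContinuum.FouriersLaw.Theorems.PhononMeanFreePath

open MeasureTheory Set Filter Topology
open scoped NNReal
open Literature.MathematicalPhysics.KineticTheory.HeatConduction
open Summit.AtomisticToContinuum.FouriersLaw.Theorems.IncoherentBounded (rN_sq_integrableOn CN_integrableOn kinCorr_integrableOn sumRule)

/-- **Registered stub `cumulantChannels_floor`: the two cumulant channels together carry at least `c > 0`, uniformly in `N ≥ 2`.**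
`∫₀^∞(C_N − 2r_N²) + ∫₀^∞(A_N − 2a_N²) = T²/γ − 2∫₀^∞(r_N² + a_N²) ≥ 2c'` (sum rule + strict forecast budget; every integrand is
integrable at fixed `N`). [folklore] -/
theorem cumulantChannels_floor : ∀ ω₂ lam β γ : ℝ, 0 < ω₂ → 0 < lam → 0 < β → 0 < γ → ∀ T : ℝ, 0 < T → ∃ c : ℝ, 0 < c ∧ ∀ N : ℕ, 2 ≤ N → c ≤ (∫ t in Ioi (0 : ℝ), (powerCov ω₂ lam β γ T N t - 2 * (pairCorr ω₂ lam β γ T N t) ^ 2)) + ∫ t in Ioi (0 : ℝ), ((∫ z, (z.2 0 ^ 2 - T) * (∫ y, (y.2 0 ^ 2 - T) ∂((pinnedChain ω₂ lam β γ).transitionKernel (N + 1) T T t.toNNReal z)) ∂((pinnedChain ω₂ lam β γ).gibbsMeasure (N + 1) T)) - 2 * (∫ z, z.2 (Fin.last N) * fcast ω₂ lam β γ T N t z ∂((pinnedChain ω₂ lam β γ).gibbsMeasure (N + 1) T)) ^ 2) := by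
  intro ω₂ lam β γ hω hl hβ hγ T hT
  obtain ⟨c', hc', hstrict⟩ := strictForecastBudget ω₂ lam β γ hω hl hβ hγ T hT
  refine ⟨2 * c', by positivity, fun N hN => ?_⟩
  -- fixed-`N` integrability of the four pieces
  have hC : IntegrableOn (fun t => powerCov ω₂ lam β γ T N t) (Ioi (0 : ℝ)) := CN_integrableOn hω hl.le hβ hγ hT N
  have hr : IntegrableOn (fun t => (pairCorr ω₂ lam β γ T N t) ^ 2) (Ioi (0 : ℝ)) := rN_sq_integrableOn hω hl.le hβ hγ hT N
  have ha : IntegrableOn (fun t => (∫ z, z.2 (Fin.last N) * fcast ω₂ lam β γ T N t z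
      ∂((pinnedChain ω₂ lam β γ).gibbsMeasure (N + 1) T)) ^ 2) (Ioi (0 : ℝ)) := aN_sq_integrableOn hω hl.le hβ hγ hT N
  have hA : IntegrableOn (fun t : ℝ => ∫ z, (z.2 0 ^ 2 - T) * (∫ y, (y.2 0 ^ 2 - T)
      ∂((pinnedChain ω₂ lam β γ).transitionKernel (N + 1) T T t.toNNReal z)) ∂((pinnedChain ω₂ lam β γ).gibbsMeasure (N + 1) T))
      (Ioi (0 : ℝ)) := kinCorr_integrableOn hω hl.le hβ hγ (Nat.succ_pos N) hT 0 0
  -- the two `N`-uniform inputs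
  have hsum := sumRule hω hl.le hβ hγ hT N
  have hS := hstrict N hN
  -- bookkeeping
  have e1 : ∫ t in Ioi (0 : ℝ), (powerCov ω₂ lam β γ T N t - 2 * (pairCorr ω₂ lam β γ T N t) ^ 2) =
      (∫ t in Ioi (0 : ℝ), powerCov ω₂ lam β γ T N t) - 2 * ∫ t in Ioi (0 : ℝ), (pairCorr ω₂ lam β γ T N t) ^ 2 := by
    rw [integral_sub hC (hr.const_mul 2), integral_const_mul]
  have e2 : ∫ t in Ioi (0 : ℝ), ((∫ z, (z.2 0 ^ 2 - T) * (∫ y, (y.2 0 ^ 2 - T)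
      ∂((pinnedChain ω₂ lam β γ).transitionKernel (N + 1) T T t.toNNReal z)) ∂((pinnedChain ω₂ lam β γ).gibbsMeasure (N + 1) T)) -
      2 * (∫ z, z.2 (Fin.last N) * fcast ω₂ lam β γ T N t z ∂((pinnedChain ω₂ lam β γ).gibbsMeasure (N + 1) T)) ^ 2) =
      (∫ t in Ioi (0 : ℝ), ∫ z, (z.2 0 ^ 2 - T) * (∫ y, (y.2 0 ^ 2 - T)
        ∂((pinnedChain ω₂ lam β γ).transitionKernel (N + 1) T T t.toNNReal z)) ∂((pinnedChain ω₂ lam β γ).gibbsMeasure (N + 1) T)) -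
      2 * ∫ t in Ioi (0 : ℝ), (∫ z, z.2 (Fin.last N) * fcast ω₂ lam β γ T N t z
        ∂((pinnedChain ω₂ lam β γ).gibbsMeasure (N + 1) T)) ^ 2 := by
    rw [integral_sub hA (ha.const_mul 2), integral_const_mul]
  have e3 : ∫ t in Ioi (0 : ℝ), ((pairCorr ω₂ lam β γ T N t) ^ 2 +
      (∫ z, z.2 (Fin.last N) * fcast ω₂ lam β γ T N t z ∂((pinnedChain ω₂ lam β γ).gibbsMeasure (N + 1) T)) ^ 2) =
      (∫ t in Ioi (0 : ℝ), (pairCorr ω₂ lam β γ T N t) ^ 2) +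
        ∫ t in Ioi (0 : ℝ), (∫ z, z.2 (Fin.last N) * fcast ω₂ lam β γ T N t z
          ∂((pinnedChain ω₂ lam β γ).gibbsMeasure (N + 1) T)) ^ 2 := integral_add hr ha
  have e4 : (∫ t in Ioi (0 : ℝ), powerCov ω₂ lam β γ T N t) =
      ∫ t in Ioi (0 : ℝ), ((∫ z, (z.2 0) ^ 2 * (∫ y, (y.2 (Fin.last N)) ^ 2
        ∂((pinnedChain ω₂ lam β γ).transitionKernel (N + 1) T T t.toNNReal z)) ∂((pinnedChain ω₂ lam β γ).gibbsMeasure (N + 1) T)) -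
        (∫ z, (z.2 0) ^ 2 ∂((pinnedChain ω₂ lam β γ).gibbsMeasure (N + 1) T)) *
        (∫ z, (∫ y, (y.2 (Fin.last N)) ^ 2 ∂((pinnedChain ω₂ lam β γ).transitionKernel (N + 1) T T t.toNNReal z))
          ∂((pinnedChain ω₂ lam β γ).gibbsMeasure (N + 1) T))) := rfl
  rw [e3] at hS
  rw [e1, e2, e4]
  have e5 : T ^ 2 / γ = 2 * (T ^ 2 / (2 * γ)) := by field_simp
  linarith

/-- **Registered stub `nearCumulantChannel_of_incoherentChannel`: the crux forces the NEAR cumulant channel to stay order one.**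
If `IncoherentChannel` holds then for every admissible parameter point there is `c > 0` with `∫₀^∞(A_N − 2a_N²) ≥ c` for all large
`N` (the far channel is `κT²/(γ²N)(1 + o(1)) → 0`, the floor `cumulantChannels_floor` stays). CONDITIONAL on the crux. [folklore] -/
theorem nearCumulantChannel_of_incoherentChannel : Summit.AtomisticToContinuum.FouriersLaw.Theses.PhononMeanFreePath.IncoherentChannel → ∀ ω₂ lam β γ : ℝ, 0 < ω₂ → 0 < lam → 0 < β → 0 < γ → ∀ T : ℝ, 0 < T → ∃ c : ℝ, 0 < c ∧ ∀ᶠ N : ℕ in atTop, c ≤ ∫ t in Ioi (0 : ℝ), ((∫ z, (z.2 0 ^ 2 - T) * (∫ y, (y.2 0 ^ 2 - T) ∂((pinnedChain ω₂ lam β γ).transitionKernel (N + 1) T T t.toNNReal z)) ∂((pinnedChain ω₂ lam β γ).gibbsMeasure (N + 1) T)) - 2 * (∫ z, z.2 (Fin.last N) * fcast ω₂ lam β γ T N t z ∂((pinnedChain ω₂ lam β γ).gibbsMeasure (N + 1) T)) ^ 2) := by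
  intro hIC ω₂ lam β γ hω hl hβ hγ T hT
  obtain ⟨c, hc, hfloor⟩ := cumulantChannels_floor ω₂ lam β γ hω hl hβ hγ T hT
  obtain ⟨κ, -, hκ⟩ := hIC ω₂ lam β γ hω hl hβ hγ T hT
  -- the crux sequence `i_N = N(γ²/T²)∫(C_N − 2r_N²)` converges, hence `∫(C_N − 2r_N²) = (T²/γ²)·i_N/N → 0`
  set I : ℕ → ℝ := fun N => ∫ t in Ioi (0 : ℝ), (powerCov ω₂ lam β γ T N t - 2 * (pairCorr ω₂ lam β γ T N t) ^ 2) with hI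
  have hseq : Tendsto (fun N : ℕ => (N : ℝ) * (γ ^ 2 / T ^ 2) * I N) atTop (𝓝 κ) := by
    refine hκ.congr' (Eventually.of_forall fun N => ?_)
    simp only [hI, powerCov, pairCorr, fcast]
  have hinv : Tendsto (fun N : ℕ => (T ^ 2 / γ ^ 2) * (1 / (N : ℝ))) atTop (𝓝 0) := by
    have h := (tendsto_one_div_atTop_nhds_zero_nat (𝕜 := ℝ)).const_mul (T ^ 2 / γ ^ 2)
    rw [mul_zero] at h
    exact h
  have hI0 : Tendsto I atTop (𝓝 0) := by
    have h := hinv.mul hseq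
    rw [zero_mul] at h
    refine h.congr' ?_
    filter_upwards [eventually_gt_atTop 0] with N hN
    have hN' : (N : ℝ) ≠ 0 := Nat.cast_ne_zero.2 (Nat.pos_iff_ne_zero.1 hN)
    field_simp
  refine ⟨c / 2, by positivity, ?_⟩
  have hsmall : ∀ᶠ N : ℕ in atTop, I N ≤ c / 2 := by
    have := (tendsto_order.1 hI0).2 (c / 2) (by positivity)
    exact this.mono fun N hN => hN.le
  filter_upwards [hsmall, eventually_ge_atTop 2] with N hN h2
  have hf := hfloor N h2
  simp only [hI] at hN
  linarith

end Summit.AtomisticToContinuum.FouriersLaw.Theorems.PhononMeanFreePath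

end
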